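import Summits.QuantumFields.BalabanUV.Beta.GAN24.StripLegUnits

/-!
# `BalabanUV.Beta.GAN24.StripLegUnitsJM` — binder row G-an2-4 ∕ (CONV-C), lineage gan24-p3 (part P3, Woodbury ∕ fibre layer):
# **(U2) OF ROAD P1's ROW L10 ((I3′), cut «(M4) scaled alias-space Neumann, two anchors») AT RELATIVE BLOCKING `Lc^m`** — the sup bound of the phase-dressed
# leg sum `kFibW (Lc^(j+m)) (Lc^j) (sfStep Lc j) (smStep 3 Lc j)` of the unit-rescaled (j, m)-resolvent on the strip, at box representatives mod `Lc^m`,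
# AS A FUNCTION of F7's scaled a-priori bound at the fine blocking `N = Lc^(j+m)`, with the `j`-FREE constant `StripLegUnits.cstSq A η (Lc^m) r₀`

NOT IN PRINT; OUR PROOF ([folklore] bookkeeping over `ℝ`∕`ℂ`: road P1's generic four squared leg bounds `StripLegUnits.ff_sq_le ∕ fm_sq_le ∕ mf_sq_le ∕ mm_sq_le`
(any sides `0 < M ≤ N`) instantiated at `(N, M) = (Lc^(j+m), Lc^j)` — ratio `N∕M = Lc^m` — and the four unit identities re-run with the decimation level `j`
and the relative blocking `m` decoupled; at `m = 1` this is `StripLegUnits.norm_kFibΔ_sq_le_cstSq` up to the phase re-basing).  HONEST FRAMING (cell contract,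
verbatim): «discharging `BetaPertH` makes Bałaban's UV stability UNCONDITIONAL — a real constructive-QFT result; it is NOT the continuum limit and NOT the Clay
problem.»  HONEST DEPENDENCY (verbatim): «continuum YM on T⁴ ⇐ BetaPertH ∧ nine spine estimates (0/9 proved); BetaPertH ⇐ (D1) ∧ (D4) ∧ CAP+tail; G-an2-4
gates asym, D1 and NE2/3/4.»  No cited fact, no wall binder, no `def`, no `def … : Prop` (F7's a-priori bound and the cut's slot∕row weight bounds are explicit
`∀`-hypotheses, exactly as in `StripLegUnits`); nothing of (CONV-C) is discharged here.  NOT summit progress.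

## What is proved (`d = 3`, `D = 4`; `l = Lc`, `N = l^(j+m)`, `M = l^j`, `sfStep Lc j = l^j`, `smStep 3 Lc j = l^(4j)`)
* §1 `pow_le_pow_add` (`Lc^j ≤ Lc^(j+m)`), `quo_pow_add_smul_repZ` (the `N`-block index of `M • repZ z`, `z ∈ (ℤ∕Lc^m)^D`, vanishes), and the four UNIT IDENTITIES
  at ratio `l^m`: `unit_ff_m` (`sf⁴·N⁻⁸·(R0² + RE²·624) = (r₀⁻⁴ + 39)·(l^m)⁻⁴`), `unit_fm_m` (`sf²·(RQ·sm)² = (l^m)⁻¹⁰`), `unit_mf_m`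
  (`(Sφ·sm)²·sf²·N⁻⁸·(R0² + RE²·624) = (1 + 39 r₀⁴)·(l^m)⁻¹⁰`), `unit_mm_m` (`(Sφ·sm)²·(RQ·sm)² = r₀⁴·(l^m)⁻¹⁶`) — the decimation level `j` CANCELS.
* §2 **`norm_kFibW_jm_sq_le_cstSq`**: on `|Im p_i| ≤ η ≤ 1/4`, `|Re p_i| ≤ π`, for positive slot weights `σ` and row weights `ρ` of the cut's scaling at `N = Lc^(j+m)`
  with zero-alias radius `r₀ > 0` (A-slots `σ ≤ 1`, φ-slots `σ ≤ r₀²/N³`, EL rows `|ρ| ≤ N²/r₀²` on ∕ `≤ N²/4` off the zero alias, Q rows `|ρ| ≤ N⁻⁵`) and the scaled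
  a-priori bound with constant `A` for `arrowMat (aliasArrow N p)`:
  `‖kFibW (Lc^(j+m)) (Lc^j) (sfStep Lc j) (smStep 3 Lc j) a (repZ zx) b (repZ zy) p‖² ≤ cstSq A η (Lc^m) r₀` for all legs and all box representatives `zx zy` mod `Lc^m`;
  un-squared form `norm_kFibW_jm_le_sqrt_cstSq`.  The constant is road P1's (U2) constant read at `Lc := Lc^m` — `j`-FREE.
Consumer: `GAN24/FibreStripJMHolds` ((I3′) at relative blocking `Lc^m`).  NOT BetaPertH, NOT continuum, NOT Clay.
-/

noncomputable section

open Complex Finset Matrix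
open scoped BigOperators Real
open Literature.Probability.LatticeModels (TorusSite Torus.proj)
open Literature.MathematicalPhysics.QuantumFieldTheory
open Literature.MathematicalPhysics.QuantumFieldTheory.LatticeForm (quo repZ)
open Literature.MathematicalPhysics.QuantumFieldTheory.Balaban1983to89
open Literature.MathematicalPhysics.QuantumFieldTheory.Balaban1983to89.Beta
open AffineAveraging (Site)
open BlochFibreMatrix (repZ_nonneg repZ_lt)
open FibreInverseDecay (cphase)
open OneStepResolventKernel (Fib)
open Summit.QuantumFields.BalabanUV.Beta.GAN24.CombesThomas (sfStep smStep)
open Summit.QuantumFields.BalabanUV.Beta.GAN24.CombesThomasFibreStep (kFibW cphase_zero_left)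
open Summit.QuantumFields.BalabanUV.Beta.GAN24.ArrowOperator (AIdx arrowMat aliasArrow)
open Summit.QuantumFields.BalabanUV.Beta.GAN24.StripLegUnits (ff_sq_le fm_sq_le mf_sq_le mm_sq_le cstSq cstSq_nonneg term1_le_cstSq term2_le_cstSq
  term3_le_cstSq term4_le_cstSq lc_pos pow_pos' exp_offset_repZ_le)

namespace Summit.QuantumFields.BalabanUV.Beta.GAN24.StripLegUnitsJM

variable {Lc : ℕ} [NeZero Lc]

/-! ## §1 Arithmetic at relative blocking `Lc^m` -/

/-- [folklore] `Lc^j ≤ Lc^(j+m)`. -/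
theorem pow_le_pow_add (j m : ℕ) : Lc ^ j ≤ Lc ^ (j + m) :=
  Nat.pow_le_pow_right (Nat.pos_of_ne_zero (NeZero.ne Lc)) (Nat.le_add_right j m)

/-- [folklore] **THE MULTIPLIER-LEG BLOCK INDEX (blocking `Lc^(j+m)`) OF A BOX REPRESENTATIVE mod `Lc^m` ON THE STEP-`j` LATTICE VANISHES**:
`quo (Lc^(j+m)) (Lc^j • repZ z) = 0` for `z ∈ (ℤ∕Lc^m)^D` (`0 ≤ Lc^j·z_i < Lc^j·Lc^m`). -/
theorem quo_pow_add_smul_repZ {D : ℕ} (j m : ℕ) (z : TorusSite D (Lc ^ m)) :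
    quo (Lc ^ (j + m)) ((((Lc ^ j : ℕ) : ℤ)) • repZ z) = 0 := by
  funext i
  simp only [quo, Pi.smul_apply, smul_eq_mul, Pi.zero_apply]
  have h0 : 0 ≤ ((Lc ^ j : ℕ) : ℤ) * repZ z i := mul_nonneg (by positivity) (repZ_nonneg z i)
  have h1 : ((Lc ^ j : ℕ) : ℤ) * repZ z i < ((Lc ^ (j + m) : ℕ) : ℤ) := by
    have hz := repZ_lt z i
    have hL : (0 : ℤ) < ((Lc ^ j : ℕ) : ℤ) := by exact_mod_cast pow_pos' (Lc := Lc) j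
    calc ((Lc ^ j : ℕ) : ℤ) * repZ z i < ((Lc ^ j : ℕ) : ℤ) * ((Lc ^ m : ℕ) : ℤ) := mul_lt_mul_of_pos_left hz hL
      _ = ((Lc ^ (j + m) : ℕ) : ℤ) := by push_cast; ring
  exact Int.ediv_eq_zero_of_lt h0 h1

/-! ### The four unit identities at ratio `l^m` (`sf = l^j`, `sm = l^(4j)`, `N = l^(j+m)`): the level `j` cancels -/

/-- [folklore] ff: `sf²·sf²·N⁻⁸·(R0² + RE²·624) = (r₀⁻⁴ + 39)·(l^m)⁻⁴` with `R0 = N²/r₀²`, `RE = N²/4`. -/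
theorem unit_ff_m {l r₀ : ℝ} (hl : l ≠ 0) (hr : r₀ ≠ 0) (j m : ℕ) :
    (l ^ j) ^ 2 * (l ^ j) ^ 2 * (((l ^ (j + m)) ^ (3 + 1)) ^ 2)⁻¹ *
        (((l ^ (j + m)) ^ 2 / r₀ ^ 2) ^ 2 + ((l ^ (j + m)) ^ 2 / 4) ^ 2 * ((5 : ℝ) ^ (3 + 1) - 1)) = (r₀⁻¹ ^ 4 + 39) * ((l ^ m) ^ 4)⁻¹ := by
  have ha : l ^ j ≠ 0 := pow_ne_zero _ hl
  have hL : l ^ m ≠ 0 := pow_ne_zero _ hl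
  rw [pow_add]
  field_simp
  ring

/-- [folklore] fm: `sf²·(RQ·sm)² = (l^m)⁻¹⁰` with `RQ = N⁻⁵`. -/
theorem unit_fm_m {l : ℝ} (hl : l ≠ 0) (j m : ℕ) :
    (l ^ j) ^ 2 * ((((l ^ (j + m)) ^ 5)⁻¹ * l ^ (j * 4)) ^ 2) = ((l ^ m) ^ 10)⁻¹ := by
  have ha : l ^ j ≠ 0 := pow_ne_zero _ hl
  have hL : l ^ m ≠ 0 := pow_ne_zero _ hl
  rw [pow_add, pow_mul]
  field_simp

/-- [folklore] mf: `(Sφ·sm)²·sf²·N⁻⁸·(R0² + RE²·624) = (1 + 39·r₀⁴)·(l^m)⁻¹⁰` with `Sφ = r₀²/N³`. -/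
theorem unit_mf_m {l r₀ : ℝ} (hl : l ≠ 0) (hr : r₀ ≠ 0) (j m : ℕ) :
    (r₀ ^ 2 / (l ^ (j + m)) ^ 3 * l ^ (j * 4)) ^ 2 * ((l ^ j) ^ 2 * (((l ^ (j + m)) ^ (3 + 1)) ^ 2)⁻¹ *
        (((l ^ (j + m)) ^ 2 / r₀ ^ 2) ^ 2 + ((l ^ (j + m)) ^ 2 / 4) ^ 2 * ((5 : ℝ) ^ (3 + 1) - 1))) = (1 + 39 * r₀ ^ 4) * ((l ^ m) ^ 10)⁻¹ := by
  have ha : l ^ j ≠ 0 := pow_ne_zero _ hl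
  have hL : l ^ m ≠ 0 := pow_ne_zero _ hl
  rw [pow_add, pow_mul]
  field_simp
  ring

/-- [folklore] mm: `(Sφ·sm)²·(RQ·sm)² = r₀⁴·(l^m)⁻¹⁶`. -/
theorem unit_mm_m {l r₀ : ℝ} (hl : l ≠ 0) (j m : ℕ) :
    (r₀ ^ 2 / (l ^ (j + m)) ^ 3 * l ^ (j * 4)) ^ 2 * ((((l ^ (j + m)) ^ 5)⁻¹ * l ^ (j * 4)) ^ 2) = r₀ ^ 4 * ((l ^ m) ^ 16)⁻¹ := by
  have ha : l ^ j ≠ 0 := pow_ne_zero _ hl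
  have hL : l ^ m ≠ 0 := pow_ne_zero _ hl
  rw [pow_add, pow_mul]
  field_simp

/-! ## §2 (U2) at relative blocking `Lc^m`: the `j`-free constant `cstSq A η (Lc^m) r₀` -/

variable {η A r₀ : ℝ}

/-- [folklore] **(U2) AT RELATIVE BLOCKING `Lc^m` AS A FUNCTION OF THE SCALED A-PRIORI BOUND, `d = 3`, SQUARED FORM.**  At step `j` and relative blocking `m`
(`N = Lc^(j+m)`, `M = Lc^j`), on the strip `|Im p_i| ≤ η ≤ 1/4`, `|Re p_i| ≤ π`: if positive slot weights `σ` and row weights `ρ` satisfy the cut's bounds with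
zero-alias radius `r₀ > 0` at blocking `N` and the scaled a-priori bound with constant `A` holds for `arrowMat (aliasArrow N p)`, then for all legs and all box
representatives `zx zy` mod `Lc^m`: `‖kFibW (Lc^(j+m)) (Lc^j) (sfStep Lc j) (smStep 3 Lc j) a (repZ zx) b (repZ zy) p‖² ≤ cstSq A η (Lc^m) r₀`. -/
theorem norm_kFibW_jm_sq_le_cstSq (hη : 0 ≤ η) (hη4 : η ≤ 1 / 4) (hr₀ : 0 < r₀) (m j : ℕ) {p : Fin 4 → ℂ}
    (him : ∀ i, |(p i).im| ≤ η) (hre : ∀ i, |(p i).re| ≤ π)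
    (σ ρ : AIdx 4 (TorusSite 4 (Lc ^ (j + m))) → ℝ) (hσ : ∀ i, 0 < σ i)
    (hσA : ∀ n κ, σ (Sum.inl (Sum.inl κ, n)) ≤ 1)
    (hσφ : ∀ κ, σ (Sum.inr (Sum.inl κ)) ≤ r₀ ^ 2 / ((Lc : ℝ) ^ (j + m)) ^ 3)
    (hρ0 : ∀ κ, |ρ (Sum.inl (Sum.inl κ, 0))| ≤ ((Lc : ℝ) ^ (j + m)) ^ 2 / r₀ ^ 2)
    (hρE : ∀ n, n ≠ 0 → ∀ κ, |ρ (Sum.inl (Sum.inl κ, n))| ≤ ((Lc : ℝ) ^ (j + m)) ^ 2 / 4)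
    (hρQ : ∀ κ, |ρ (Sum.inr (Sum.inl κ))| ≤ (((Lc : ℝ) ^ (j + m)) ^ 5)⁻¹)
    (hAP : ∀ x, ∑ i, (‖x i‖ / σ i) ^ 2 ≤ A ^ 2 * ∑ i, (ρ i * ‖(arrowMat (aliasArrow (Lc ^ (j + m)) p) *ᵥ x) i‖) ^ 2)
    (a b : Fib 3) (zx zy : TorusSite 4 (Lc ^ m)) :
    ‖kFibW (Lc ^ (j + m)) (Lc ^ j) (sfStep Lc j) (smStep 3 Lc j) a (repZ zx) b (repZ zy) p‖ ^ 2 ≤ cstSq A η (Lc ^ m) r₀ := by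
  have hl : (0 : ℝ) < Lc := lc_pos
  have hl0 : (Lc : ℝ) ≠ 0 := hl.ne'
  have hr0 : r₀ ≠ 0 := hr₀.ne'
  have hM : 0 < Lc ^ j := pow_pos' j
  have hMN : Lc ^ j ≤ Lc ^ (j + m) := pow_le_pow_add j m
  have hNR : ((Lc ^ (j + m) : ℕ) : ℝ) = (Lc : ℝ) ^ (j + m) := Nat.cast_pow Lc (j + m)
  have hLR : ((Lc ^ m : ℕ) : ℝ) = (Lc : ℝ) ^ m := Nat.cast_pow Lc m
  have hratio : ((Lc ^ (j + m) : ℕ) : ℝ) / ((Lc ^ j : ℕ) : ℝ) = (Lc : ℝ) ^ m := by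
    rw [Nat.cast_pow, Nat.cast_pow, pow_add, mul_div_cancel_left₀ _ (pow_ne_zero _ hl0)]
  have hsf : sfStep Lc j = (Lc : ℝ) ^ j := rfl
  have hsm : smStep 3 Lc j = (Lc : ℝ) ^ (j * 4) := rfl
  have hsm0 : 0 ≤ smStep 3 Lc j := by rw [hsm]; positivity
  have hφx : cphase (quo (Lc ^ (j + m)) (((Lc ^ j : ℕ) : ℤ) • repZ zx)) p = 1 := by rw [quo_pow_add_smul_repZ, cphase_zero_left]
  have hφy : cphase (-quo (Lc ^ (j + m)) (((Lc ^ j : ℕ) : ℤ) • repZ zy)) p = 1 := by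
    rw [quo_pow_add_smul_repZ, neg_zero, cphase_zero_left]
  have hex := exp_offset_repZ_le (Lc := Lc ^ m) hη zx
  have hey := exp_offset_repZ_le (Lc := Lc ^ m) hη zy
  have t1 := term1_le_cstSq A η (Lc ^ m) r₀
  have t2 := term2_le_cstSq A η (Lc ^ m) r₀
  have t3 := term3_le_cstSq A η (Lc ^ m) r₀
  have t4 := term4_le_cstSq A η (Lc ^ m) r₀
  rw [hLR] at hex hey t1 t2 t3 t4
  rcases a with κ | κ <;> rcases b with l' | l'
  · -- ff
    have h := ff_sq_le (N := Lc ^ (j + m)) (M := Lc ^ j) (sf := sfStep Lc j) (sm := smStep 3 Lc j) him hre hη hη4 hM hMN hσ hσA hAP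
      κ (repZ zx) l' (repZ zy) (hρ0 l') (fun n hn => hρE n hn l')
    rw [hratio, hNR, hsf] at h
    set ex : ℝ := Real.exp (η * ∑ i, |((repZ zx i : ℤ) : ℝ)|) with hexd
    set ey : ℝ := Real.exp (η * ∑ i, |((repZ zy i : ℤ) : ℝ)|) with heyd
    set E : ℝ := Real.exp (η * (4 * (Lc : ℝ) ^ m)) with hE
    set l : ℝ := (Lc : ℝ) with hldef
    calc _ ≤ _ := h
      _ = A ^ 2 * ((l ^ j) ^ 2 * (l ^ j) ^ 2 * (((l ^ (j + m)) ^ (3 + 1)) ^ 2)⁻¹ *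
              (((l ^ (j + m)) ^ 2 / r₀ ^ 2) ^ 2 + ((l ^ (j + m)) ^ 2 / 4) ^ 2 * ((5 : ℝ) ^ (3 + 1) - 1))) *
            (ex ^ 2 * ey ^ 2 * ((6 : ℝ) ^ (3 + 1 + 1) * (((l ^ m) ^ 2) ^ (3 + 1) * (5 : ℝ) ^ (3 + 1))) *
              ((6 : ℝ) ^ (3 + 1 + 1) * ((l ^ m) ^ 2) ^ (3 + 1))) := by
          ring
      _ ≤ A ^ 2 * ((r₀⁻¹ ^ 4 + 39) * ((l ^ m) ^ 4)⁻¹) *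
            (E ^ 2 * E ^ 2 * ((6 : ℝ) ^ (3 + 1 + 1) * (((l ^ m) ^ 2) ^ (3 + 1) * (5 : ℝ) ^ (3 + 1))) *
              ((6 : ℝ) ^ (3 + 1 + 1) * ((l ^ m) ^ 2) ^ (3 + 1))) := by
          rw [unit_ff_m hl0 hr0 j m]
          gcongr
      _ = A ^ 2 * (E ^ 4 * ((6 : ℝ) ^ 10 * (5 : ℝ) ^ 4 * (l ^ m) ^ 12) * (r₀⁻¹ ^ 4 + 39)) := by
          field_simp
          ring
      _ ≤ cstSq A η (Lc ^ m) r₀ := t1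
  · -- fm
    have h := fm_sq_le (N := Lc ^ (j + m)) (M := Lc ^ j) (sf := sfStep Lc j) (sm := smStep 3 Lc j) him hre hη hη4 hM hMN hσ hσA
      (by positivity) hsm0 hAP κ (repZ zx) l' (repZ zy) (hρQ l')
    rw [hratio, hsf, hsm, hφy, norm_one, mul_one] at h
    set ex : ℝ := Real.exp (η * ∑ i, |((repZ zx i : ℤ) : ℝ)|) with hexd
    set E : ℝ := Real.exp (η * (4 * (Lc : ℝ) ^ m)) with hE
    set l : ℝ := (Lc : ℝ) with hldef
    calc _ ≤ _ := h
      _ = A ^ 2 * ((l ^ j) ^ 2 * ((((l ^ (j + m)) ^ 5)⁻¹ * l ^ (j * 4)) ^ 2)) *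
            (ex ^ 2 * ((6 : ℝ) ^ (3 + 1 + 1) * (((l ^ m) ^ 2) ^ (3 + 1) * (5 : ℝ) ^ (3 + 1)))) := by ring
      _ ≤ A ^ 2 * ((l ^ m) ^ 10)⁻¹ * (E ^ 2 * ((6 : ℝ) ^ (3 + 1 + 1) * (((l ^ m) ^ 2) ^ (3 + 1) * (5 : ℝ) ^ (3 + 1)))) := by
          rw [unit_fm_m hl0 j m]
          gcongr
      _ = A ^ 2 * (E ^ 2 * ((6 : ℝ) ^ 5 * (5 : ℝ) ^ 4) * ((l ^ m) ^ 2)⁻¹) := by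
          field_simp
          ring
      _ ≤ cstSq A η (Lc ^ m) r₀ := t2
  · -- mf
    have h := mf_sq_le (N := Lc ^ (j + m)) (M := Lc ^ j) (sf := sfStep Lc j) (sm := smStep 3 Lc j) him hre hη hη4 hM hMN hσ hσφ hsm0 hAP
      κ (repZ zx) l' (repZ zy) (hρ0 l') (fun n hn => hρE n hn l')
    rw [hratio, hNR, hsf, hsm, hφx, norm_one, mul_one] at h
    set ey : ℝ := Real.exp (η * ∑ i, |((repZ zy i : ℤ) : ℝ)|) with heyd
    set E : ℝ := Real.exp (η * (4 * (Lc : ℝ) ^ m)) with hE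
    set l : ℝ := (Lc : ℝ) with hldef
    calc _ ≤ _ := h
      _ = A ^ 2 * ((r₀ ^ 2 / (l ^ (j + m)) ^ 3 * l ^ (j * 4)) ^ 2 * ((l ^ j) ^ 2 * (((l ^ (j + m)) ^ (3 + 1)) ^ 2)⁻¹ *
              (((l ^ (j + m)) ^ 2 / r₀ ^ 2) ^ 2 + ((l ^ (j + m)) ^ 2 / 4) ^ 2 * ((5 : ℝ) ^ (3 + 1) - 1)))) *
            (ey ^ 2 * ((6 : ℝ) ^ (3 + 1 + 1) * ((l ^ m) ^ 2) ^ (3 + 1))) := by ring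
      _ ≤ A ^ 2 * ((1 + 39 * r₀ ^ 4) * ((l ^ m) ^ 10)⁻¹) * (E ^ 2 * ((6 : ℝ) ^ (3 + 1 + 1) * ((l ^ m) ^ 2) ^ (3 + 1))) := by
          rw [unit_mf_m hl0 hr0 j m]
          gcongr
      _ = A ^ 2 * (E ^ 2 * (6 : ℝ) ^ 5 * (1 + 39 * r₀ ^ 4) * ((l ^ m) ^ 2)⁻¹) := by
          field_simp
          ring
      _ ≤ cstSq A η (Lc ^ m) r₀ := t3
  · -- mm
    have h := mm_sq_le (N := Lc ^ (j + m)) (M := Lc ^ j) (sf := sfStep Lc j) (sm := smStep 3 Lc j) (p := p) hσ hσφ (by positivity) hsm0 hAP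
      κ (repZ zx) l' (repZ zy) (hρQ l')
    rw [hsm, hφx, hφy, norm_one, mul_one, mul_one] at h
    set l : ℝ := (Lc : ℝ) with hldef
    calc _ ≤ _ := h
      _ = A ^ 2 * ((r₀ ^ 2 / (l ^ (j + m)) ^ 3 * l ^ (j * 4)) ^ 2 * ((((l ^ (j + m)) ^ 5)⁻¹ * l ^ (j * 4)) ^ 2)) := by ring
      _ = A ^ 2 * (r₀ ^ 4 * ((l ^ m) ^ 16)⁻¹) := by rw [unit_mm_m hl0 j m]
      _ ≤ cstSq A η (Lc ^ m) r₀ := t4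

/-- [folklore] **(U2) AT RELATIVE BLOCKING `Lc^m`, un-squared**: `‖kFibW (Lc^(j+m)) (Lc^j) (sfStep Lc j) (smStep 3 Lc j) a (repZ zx) b (repZ zy) p‖ ≤ √(cstSq A η (Lc^m) r₀)`. -/
theorem norm_kFibW_jm_le_sqrt_cstSq (hη : 0 ≤ η) (hη4 : η ≤ 1 / 4) (hr₀ : 0 < r₀) (m j : ℕ) {p : Fin 4 → ℂ}
    (him : ∀ i, |(p i).im| ≤ η) (hre : ∀ i, |(p i).re| ≤ π)
    (σ ρ : AIdx 4 (TorusSite 4 (Lc ^ (j + m))) → ℝ) (hσ : ∀ i, 0 < σ i)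
    (hσA : ∀ n κ, σ (Sum.inl (Sum.inl κ, n)) ≤ 1)
    (hσφ : ∀ κ, σ (Sum.inr (Sum.inl κ)) ≤ r₀ ^ 2 / ((Lc : ℝ) ^ (j + m)) ^ 3)
    (hρ0 : ∀ κ, |ρ (Sum.inl (Sum.inl κ, 0))| ≤ ((Lc : ℝ) ^ (j + m)) ^ 2 / r₀ ^ 2)
    (hρE : ∀ n, n ≠ 0 → ∀ κ, |ρ (Sum.inl (Sum.inl κ, n))| ≤ ((Lc : ℝ) ^ (j + m)) ^ 2 / 4)
    (hρQ : ∀ κ, |ρ (Sum.inr (Sum.inl κ))| ≤ (((Lc : ℝ) ^ (j + m)) ^ 5)⁻¹)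
    (hAP : ∀ x, ∑ i, (‖x i‖ / σ i) ^ 2 ≤ A ^ 2 * ∑ i, (ρ i * ‖(arrowMat (aliasArrow (Lc ^ (j + m)) p) *ᵥ x) i‖) ^ 2)
    (a b : Fib 3) (zx zy : TorusSite 4 (Lc ^ m)) :
    ‖kFibW (Lc ^ (j + m)) (Lc ^ j) (sfStep Lc j) (smStep 3 Lc j) a (repZ zx) b (repZ zy) p‖ ≤ Real.sqrt (cstSq A η (Lc ^ m) r₀) :=
  Real.le_sqrt_of_sq_le (norm_kFibW_jm_sq_le_cstSq hη hη4 hr₀ m j him hre σ ρ hσ hσA hσφ hρ0 hρE hρQ hAP a b zx zy)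

end Summit.QuantumFields.BalabanUV.Beta.GAN24.StripLegUnitsJM

end
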